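import Summits.FinalStateConjecture.Statement
import Literature.Geometry.Lorentzian.TameGenericityDiagonal
import Literature.Geometry.Lorentzian.TameFamilyOffCompact
import Literature.Geometry.Lorentzian.SmoothDataFamilyLocal
import Literature.Geometry.Lorentzian.TameBreathingCurve
import HarnessLib

/-!
# Crux ideas `jet-and-broom` and `broomed-rewitnessing` (crux stmt-FinalStateConjecture-13550, round 2, ideator 5) — first-lemma sketch

Crux: `Summit.FinalStateConjecture.FinalStateConjecture.Theses.StarvedNecks.HonestFixedRadiusSettling` (G).
The route module `Theses.StarvedNecks` is NOT imported (its in-file `closes` no longer elaborates against the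
summit re-typed 2026-08-16T21:18Z, leads c5–c7); as in `Disproof.lean` §0 and `RetypeKitC5.lean` the crux's
let-bound predicates are copied VERBATIM (`HonestCore`, `HonestFar`, `SettlesHonestly`) and `G` below is the crux
body with the lets ζ-reduced to the named copies (Disproof: `crux_iff_codim_one : HonestFixedRadiusSettling ↔ Codim 1
:= Iff.rfl`).  `GT` is lead c5's restatement G′ (tame genericity + `RaysStayInClosure`), copied from
`Cruxes/HonestFixedRadiusSettling/RetypeKitC5.lean`.

## Content

* §0 verbatim copies: `HonestCore`, `HonestFar`, `SettlesHonestly` (= P_G, `k = 4`), `SettlesHonestlyT`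
  (= P_G′: the same with `RaysStayInClosure`), `G`, `GT`.
* §1 THE TRANSFER TARGET of the card, per slice `X` and PARAMETRIC IN THE POINTWISE PROPERTY `P`:
  `JetBroomCure X Clean P` — through every admissible datum `d` failing `P` passes ONE jointly smooth admissible
  two-parameter family `H (c, s)` ("jet ∘ broom"): the axis `s = 0` is a compactly supported JET through `d`
  (agrees with `d` off a fixed compact `K`, immersed at `0`, injective); the BROOM parameter `s` recedes
  (near every point of `X`, for small `s`, `H (c, s) = H (c, 0)`), every member off the jet axis is CLEAN-ENDED
  (`Clean e (H (c, s))` for `s ≠ 0` — instantiated by the line with "exact Kerr Boyer–Lindquist-slice end beyond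
  some radius"), the family is TAME on one end `e` at `(0, 0)`; and THE CURE: for `0 < |c| < ε` and all
  sufficiently small `s ≠ 0` (= all sufficiently FAR brooms), `P (H (c, s))`.
* §2 PLUMBING, proved: `isImmersedAtZero_congr` — immersion at `0` passes between families whose sections agree,
  near every point of `X`, for all small parameters (so the composite `t ↦ H (φ t, ψ t)` inherits immersion from
  the jet: the broom is invisible to first order at `t = 0`).
* §3 THE FIRST LEMMA of the line (signatures, `sorry`): `isTameChristodoulouGeneric_of_jetBroomCure`
  (C⁺ ⇒ tame codimension one of `P`, for EVERY `Clean` and `P`), hence `GT_of_jetBroomCure` (the restated crux)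
  and `G_of_jetBroomCure` (the crux as typed, via `IsTameChristodoulouGeneric.isChristodoulouGeneric`).
* §4 SECOND CARD `broomed-rewitnessing` (a different lever: composition of tame genericities ALONG CURVES,
  `isTameChristodoulouGeneric_of_relative'`): `SettlesUnexhaustively` (the summit's conclusion minus
  `HasExhaustiveCharts`), `QT` (its tame genericity), `QT_of_summit` (PROVED: weaker than the summit),
  `BroomedReWitness X` (route-owned ∀-statement), `GT_of_QT_of_rewitness : QT → (∀ X, BroomedReWitness X) → GT`
  (PROVED) and `G_of_QT_of_rewitness` (PROVED).

Nothing here is a proposal; `sorry` only in §3 (crux-ideate: "it need not be proved, it must elaborate").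
`lean check` (farm, 2026-08-16): rc 0, 1 sorry, axioms standard.
-/

noncomputable section

set_option linter.dupNamespace false

open Literature.Geometry.Lorentzian
open scoped Manifold ContDiff ENNReal Topology
open Filter Set Function

namespace Summit.FinalStateConjecture.FinalStateConjecture.Cruxes.HonestFixedRadiusSettling.JetAndBroom

/-! ### §0 Verbatim copies of the crux's predicates (Disproof.lean §0) -/

/-- `HonestCore d R₀` — verbatim the let-bound `Hc` of the crux. -/
def HonestCore (𝓢 : Spacetime.{0} 4) (O : Set 𝓢.carrier) (k : ℕ) (d : FinalStateDecomposition 𝓢 O k)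
    (R₀ : ℝ) : Prop :=
  let B := d.background; let t := fun i ↦ (B i).time; let r := fun i ↦ (B i).radius; let Ψ := d.chart;
  (∀ i, Kerr.IsSubextremal (d.mass i) (d.spin i) ∧ 100 * d.mass i ≤ R₀ ∧
      0 < ((d.motion i).1 : E4 ≃L[ℝ] E4) (E4.basisVector 0) 0) ∧
  (∀ i (ϱ τ₂ : ℝ), R₀ ≤ ϱ → d.τ₀ < τ₂ →
      Ψ i '' {x | d.τ₀ < t i x.1 ∧ t i x.1 < τ₂ ∧ r i x.1 < ϱ} ⊆
        𝓢.metric.causalPast 𝓢.timeOrientation (Ψ i '' (B i).truncTimeSlab ϱ τ₂)) ∧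
  (∀ i (τ' : ℝ) (ϱ : ℝ → ℝ), Continuous ϱ → d.τ₀ < τ' →
      let A := Ψ i '' {x | τ' ≤ t i x.1 ∧ r i x.1 ≤ ϱ (t i x.1)}; closure A ∩ O ⊆ A) ∧
  (∀ y : d.flatDomain, d.τ₀ < y.1 0 →
      𝓢.timeOrientation.IsFutureDirected (mfderiv 𝓘(ℝ, E4) (𝓡 4) d.flatChart y (E4.basisVector 0)))

/-- `HonestFar d R₀` — verbatim the let-bound `Hf` of the crux. -/
def HonestFar (𝓢 : Spacetime.{0} 4) (O : Set 𝓢.carrier) (k : ℕ) (d : FinalStateDecomposition 𝓢 O k)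
    (R₀ : ℝ) : Prop :=
  let B := d.background; let t := fun i ↦ (B i).time; let r := fun i ↦ (B i).radius; let Φ := d.flatChart;
  (∀ τ₂ : ℝ, d.τ₀ < τ₂ → Φ '' {y | d.τ₀ < y.1 0 ∧ y.1 0 < τ₂} ⊆
      𝓢.metric.causalPast 𝓢.timeOrientation (Φ '' (Minkowski.backgroundOn d.flatDomain).timeSlab τ₂)) ∧
  (∀ τ' : ℝ, d.τ₀ < τ' →
      closure (Φ '' {y | τ' ≤ y.1 0 ∧ ∀ i, d.excision i (y.1 0) + 1 ≤ r i y.1}) ⊆ Φ '' {y | τ' ≤ y.1 0}) ∧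
  (∀ i, ∃ T : ℝ, supCkENorm (Subtype.val '' {x : (B i).domain | T ≤ t i x.1 ∧ R₀ ≤ r i x.1 ∧
      ∀ j, j ≠ i → r i x.1 ≤ r j x.1}) 0 (𝓢.deviationExtend (B i) (d.chart i)) ≤
        ENNReal.ofReal (1 / (10 * ‖(((d.motion i).1 : E4 ≃L[ℝ] E4) : E4 →L[ℝ] E4)‖ ^ 2)))

section Pointwise

variable {X : Type} [TopologicalSpace X] [ChartedSpace E3 X] [IsManifold (𝓡 3) ∞ X] [ConnectedSpace X]

/-- P_G: the pointwise property whose genericity the crux (as typed) asserts (Disproof §0, verbatim). -/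
def SettlesHonestly (D : InitialDataSet (𝓡 3) X) : Prop :=
  (∃ 𝒟 : VacuumCauchyDevelopment D, 𝒟.IsMaximal) ∧
    ∀ 𝒟 : VacuumCauchyDevelopment D, 𝒟.IsMaximal →
      HasCompleteNullInfinity 𝒟.toCauchyDevelopment ∧
        ∃ (O : Set 𝒟.carrier) (d : FinalStateDecomposition 𝒟.toSpacetime O 4) (R₀ : ℝ),
          O = exteriorOf 𝒟.toCauchyDevelopment d.charted ∧
            HonestCore 𝒟.toSpacetime O 4 d R₀ ∧ HonestFar 𝒟.toSpacetime O 4 d R₀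

/-- P_G′: the pointwise property of lead c5's restatement G′ (the same, with the honest-`O` clause
`RaysStayInClosure` inserted after `O = exteriorOf …`; `RetypeKitC5.lean`). -/
def SettlesHonestlyT (D : InitialDataSet (𝓡 3) X) : Prop :=
  (∃ 𝒟 : VacuumCauchyDevelopment D, 𝒟.IsMaximal) ∧
    ∀ 𝒟 : VacuumCauchyDevelopment D, 𝒟.IsMaximal →
      HasCompleteNullInfinity 𝒟.toCauchyDevelopment ∧
        ∃ (O : Set 𝒟.carrier) (d : FinalStateDecomposition 𝒟.toSpacetime O 4) (R₀ : ℝ),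
          O = exteriorOf 𝒟.toCauchyDevelopment d.charted ∧
            RaysStayInClosure 𝒟.toCauchyDevelopment O ∧
              HonestCore 𝒟.toSpacetime O 4 d R₀ ∧ HonestFar 𝒟.toSpacetime O 4 d R₀

omit [ConnectedSpace X] in
/-- P_G′ ⇒ P_G pointwise (drop the rays clause). -/
theorem settlesHonestly_of_T [ConnectedSpace X] {D : InitialDataSet (𝓡 3) X} (h : SettlesHonestlyT D) :
    SettlesHonestly D := by
  refine ⟨h.1, fun 𝒟 h𝒟 ↦ ⟨(h.2 𝒟 h𝒟).1, ?_⟩⟩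
  obtain ⟨O, d, R₀, hO, -, hc, hf⟩ := (h.2 𝒟 h𝒟).2
  exact ⟨O, d, R₀, hO, hc, hf⟩

end Pointwise

/-- **G** — the crux `StarvedNecks.HonestFixedRadiusSettling` (item 13550) with its let-bound predicates
ζ-reduced to the named copies (byte-for-byte the same Prop; Disproof `crux_iff_codim_one`). PLAIN genericity. -/
def G : Prop :=
  ∀ (X : Type) [TopologicalSpace X] [ChartedSpace E3 X] [IsManifold (𝓡 3) ∞ X] [T2Space X]
    [SecondCountableTopology X] [ConnectedSpace X],
    InitialDataSet.IsChristodoulouGeneric (admissibleVacuumData X) SettlesHonestly 1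

/-- **G′** — lead c5's restatement (`RetypeKitC5.HonestFixedRadiusSettlingT`): TAME genericity and the
honest-`O` clause. `GT → G` (`G_of_GT`). -/
def GT : Prop :=
  ∀ (X : Type) [TopologicalSpace X] [ChartedSpace E3 X] [IsManifold (𝓡 3) ∞ X] [T2Space X]
    [SecondCountableTopology X] [ConnectedSpace X],
    InitialDataSet.IsTameChristodoulouGeneric (admissibleVacuumData X) SettlesHonestlyT 1

/-- G′ ⇒ G (tame ⇒ plain, rays clause dropped by monotonicity). -/
theorem G_of_GT (h : GT) : G := by
  intro X _ _ _ _ _ _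
  have h₁ := (h X).isChristodoulouGeneric
  -- monotonicity of plain genericity in the property
  intro d hd
  have hd' : d ∈ {d ∈ admissibleVacuumData X | ¬ SettlesHonestlyT d} :=
    ⟨hd.1, fun hT ↦ hd.2 (settlesHonestly_of_T hT)⟩
  obtain ⟨F, hF, h0, hinj, hD, hE⟩ := h₁ d hd'
  refine ⟨F, hF, h0, hinj, hD, fun c hc hmem ↦ hE c hc ⟨hmem.1, fun hT ↦ hmem.2 (settlesHonestly_of_T hT)⟩⟩

/-! ### §1 The transfer target: jet ∘ broom cures -/

section Cure

variable (X : Type) [TopologicalSpace X] [ChartedSpace E3 X] [IsManifold (𝓡 3) ∞ X]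

/-- Two data on `X` have the same sections (metric and second fundamental form) at the point `x`. -/
def SameAt (D D' : InitialDataSet (𝓡 3) X) (x : X) : Prop :=
  D.h.inner x = D'.h.inner x ∧ D.k x = D'.k x

/-- The point `(c, s)` of the parameter plane `ℝ²`. -/
def pt (c s : ℝ) : EuclideanSpace ℝ (Fin 2) := WithLp.toLp 2 ![c, s]

/-- **`JetBroomCure X Clean P`** — the card's transfer target C⁺ on the slice `X`, for a clean-end predicate
`Clean` (line: "exact Kerr Boyer–Lindquist-slice end beyond some radius on the end `e`") and a pointwise
property `P` of data (line: `SettlesHonestlyT`, or `SettlesHonestly`).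

Through every admissible datum `d` with `¬ P d` passes a two-parameter family `H : ℝ² → data`,
`H (c, s)` = "the datum `d` kicked by the compactly supported JET at amplitude `c`, then swept by the BROOM at
cleaning scale `s` (cleaning radius → ∞ as `s → 0`)", such that
* JET AXIS (`s = 0`): `H (0,0) = d`; every `H (c, 0)` agrees with `d` off ONE compact `K`; the axis is immersed at
  `0` and injective (Christodoulou's `α₀ + c f`, `f` of compact support — the ONLY place where physics genericity lives);
* BROOM RECEDES: every point of `X` has a neighbourhood on which, for all small `s` and ALL `c`, `H (c, s) = H (c, 0)`;
* REGULARITY/ADMISSIBILITY: `H` is jointly smooth on `ℝ² × X`, every member is admissible, and `H` is TAME on one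
  end `e` (continuous mass, `wDist`-continuity at `(0,0)`: charge-matched brooms, `M(c, s) → M`);
* CLEAN ENDS off the axis: `Clean e (H (c, s))` for `s ≠ 0`;
* THE CURE: for `0 < |c| < ε` and `0 < |s| ≤ s₀ c` (all sufficiently far brooms; `s₀ > 0` continuous off `c = 0`),
  `P (H (c, s))`. -/
def JetBroomCure (Clean : AFEnd X → InitialDataSet (𝓡 3) X → Prop) (P : InitialDataSet (𝓡 3) X → Prop) :
    Prop :=
  ∀ d ∈ admissibleVacuumData X, ¬ P d →
    ∃ (e : AFEnd X) (K : Set X) (H : EuclideanSpace ℝ (Fin 2) → InitialDataSet (𝓡 3) X),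
      IsCompact K ∧ H (pt 0 0) = d ∧
      -- jet axis: compactly supported, immersed, injective
      (∀ c : ℝ, ∀ x ∉ K, SameAt X (H (pt c 0)) d x) ∧
      InitialDataSet.IsImmersedAtZero 1 (fun c : EuclideanSpace ℝ (Fin 1) ↦ H (pt (c 0) 0)) ∧
      Injective (fun c : ℝ ↦ H (pt c 0)) ∧
      -- the broom recedes (locally uniformly in `x`, uniformly in `c`)
      (∀ x : X, ∃ U ∈ 𝓝 x, ∀ᶠ s in 𝓝 (0 : ℝ), ∀ (c : ℝ), ∀ y ∈ U, SameAt X (H (pt c s)) (H (pt c 0)) y) ∧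
      -- regularity, admissibility, tameness on one end
      InitialDataSet.IsSmoothDataFamily 2 H ∧ (∀ p, H p ∈ admissibleVacuumData X) ∧
      InitialDataSet.IsTameDataFamily e 2 H ∧
      -- clean ends off the jet axis
      (∀ c s : ℝ, s ≠ 0 → Clean e (H (pt c s))) ∧
      -- the cure: small non-zero kicks, all sufficiently far brooms
      ∃ ε : ℝ, 0 < ε ∧ ∃ s₀ : ℝ → ℝ, (∀ c, 0 < s₀ c) ∧ ContinuousOn s₀ {c | c ≠ 0} ∧
        ∀ c : ℝ, c ≠ 0 → |c| < ε → ∀ s : ℝ, s ≠ 0 → |s| ≤ s₀ c → P (H (pt c s))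

end Cure

/-! ### §2 Plumbing (proved): the broom is invisible to first order at the base point -/

section Plumbing

variable {E : Type*} [NormedAddCommGroup E] [NormedSpace ℝ E] {H' : Type*} [TopologicalSpace H']
  {I : ModelWithCorners ℝ E H'} {Y : Type*} [TopologicalSpace Y] [ChartedSpace H' Y] [IsManifold I ∞ Y]

/-- **Immersion at `0` is a germ property in the parameter, pointwise in `x`.** If two `m`-parameter families
`F, F'` of initial data have, at EVERY point `x`, the same sections for all parameters near `0`, then `F` is
immersed at `0` iff `F'` is. Used for the composite `t ↦ H (φ t, ψ t)`: near every `x` it coincides, for small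
`t`, with the pure jet `t ↦ H (φ t, 0)` (the broom recedes), so it is immersed as soon as the jet is. -/
theorem isImmersedAtZero_congr {m : ℕ} {F F' : EuclideanSpace ℝ (Fin m) → InitialDataSet I Y}
    (h : ∀ x : Y, ∀ᶠ c in 𝓝 (0 : EuclideanSpace ℝ (Fin m)),
      (F c).h.inner x = (F' c).h.inner x ∧ (F c).k x = (F' c).k x)
    (hF : InitialDataSet.IsImmersedAtZero m F') : InitialDataSet.IsImmersedAtZero m F := by
  intro v hv
  obtain ⟨x, u, w, huw⟩ := hF v hv
  refine ⟨x, u, w, ?_⟩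
  have hh : (fun c ↦ (F c).h.inner x u w) =ᶠ[𝓝 0] fun c ↦ (F' c).h.inner x u w := by
    filter_upwards [h x] with c hc
    simp only [hc.1]
  have hk : (fun c ↦ (F c).k x u w) =ᶠ[𝓝 0] fun c ↦ (F' c).k x u w := by
    filter_upwards [h x] with c hc
    simp only [hc.2]
  rw [hh.fderiv_eq, hk.fderiv_eq]
  exact huw

/-- A family which is CONSTANT in the parameter near `0` at every point (a pure broom, a pure far-field surgery,
a burial) is never immersed at `0` (`m ≠ 0`): under TAME genericity such families witness nothing on their own. -/
theorem not_isImmersedAtZero_of_eventually_const {m : ℕ} (hm : m ≠ 0)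
    {F : EuclideanSpace ℝ (Fin m) → InitialDataSet I Y}
    (h : ∀ x : Y, ∀ᶠ c in 𝓝 (0 : EuclideanSpace ℝ (Fin m)),
      (F c).h.inner x = (F 0).h.inner x ∧ (F c).k x = (F 0).k x) :
    ¬ InitialDataSet.IsImmersedAtZero m F := by
  intro hF
  have : InitialDataSet.IsImmersedAtZero m (fun _ : EuclideanSpace ℝ (Fin m) ↦ F 0) :=
    isImmersedAtZero_congr (F' := F) (fun x ↦ by
      filter_upwards [h x] with c hc
      exact ⟨hc.1.symm, hc.2.symm⟩) hF
  exact InitialDataSet.not_isImmersedAtZero_const hm (F 0) this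

end Plumbing

/-! ### §3 The first lemma of the line (signatures; to be proved in crux-plan) -/

section Reduction

variable {X : Type} [TopologicalSpace X] [ChartedSpace E3 X] [IsManifold (𝓡 3) ∞ X] [T2Space X]
  [SecondCountableTopology X] [ConnectedSpace X]

/-- **FIRST LEMMA (jet ∘ broom ⇒ tame codimension one).** For EVERY clean-end predicate and EVERY pointwise
property `P`: `JetBroomCure X Clean P → IsTameChristodoulouGeneric (admissibleVacuumData X) P 1`.
Proof plan (all ingredients in the tree): through an exceptional `d` take `F t := H (φ t, ψ t)` with
`φ t = (ε/2) tanh t`-type (injective, `φ' 0 ≠ 0`) and a smooth `ψ`, `ψ 0 = 0`, `0 < |ψ t| ≤ s₀ (φ t)` for `t ≠ 0`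
(exists since `s₀ > 0` is continuous off `0`); `F` is jointly smooth (`IsSmoothDataFamily.comp_contDiff`), tame on
`e` (`IsTameDataFamily.comp_contDiff`, the curve passes through `(0,0)`), immersed (`isImmersedAtZero_congr` + the
receding broom + the jet's immersion), injective (two members agree on `K` with the corresponding jet members once
`|ψ| < s_K`, and jet members are determined by their restriction to `K`), admissible, and cured off `t = 0`. -/
theorem isTameChristodoulouGeneric_of_jetBroomCure
    {Clean : AFEnd X → InitialDataSet (𝓡 3) X → Prop} {P : InitialDataSet (𝓡 3) X → Prop}
    (h : JetBroomCure X Clean P) :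
    InitialDataSet.IsTameChristodoulouGeneric (admissibleVacuumData X) P 1 := by
  sorry

/-- The restated crux G′ from the cure (line instance: `Clean` = exact Kerr BL-slice end, `P = SettlesHonestlyT`). -/
theorem GT_of_jetBroomCure
    (Clean : ∀ (X : Type) [TopologicalSpace X] [ChartedSpace E3 X] [IsManifold (𝓡 3) ∞ X],
      AFEnd X → InitialDataSet (𝓡 3) X → Prop)
    (h : ∀ (X : Type) [TopologicalSpace X] [ChartedSpace E3 X] [IsManifold (𝓡 3) ∞ X] [T2Space X]
      [SecondCountableTopology X] [ConnectedSpace X], JetBroomCure X (Clean X) SettlesHonestlyT) : GT :=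
  fun X _ _ _ _ _ _ ↦ isTameChristodoulouGeneric_of_jetBroomCure (h X)

/-- The crux AS TYPED from the same cure (`G_of_GT`). -/
theorem G_of_jetBroomCure
    (Clean : ∀ (X : Type) [TopologicalSpace X] [ChartedSpace E3 X] [IsManifold (𝓡 3) ∞ X],
      AFEnd X → InitialDataSet (𝓡 3) X → Prop)
    (h : ∀ (X : Type) [TopologicalSpace X] [ChartedSpace E3 X] [IsManifold (𝓡 3) ∞ X] [T2Space X]
      [SecondCountableTopology X] [ConnectedSpace X], JetBroomCure X (Clean X) SettlesHonestlyT) : G :=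
  G_of_GT (GT_of_jetBroomCure Clean h)

end Reduction

/-! ### §4 Card `broomed-rewitnessing`: import the physics genericity ALONG CURVES

The second card's lever is `InitialDataSet.isTameChristodoulouGeneric_of_relative'`
(`TameGenericityDiagonal.lean`): a generic HYPOTHESIS `Q` enters the proof of a generic CONCLUSION `P` by
re-witnessing along `Q`-curves (with brooms), never pointwise (pointwise `Q → P_G′` is FALSE on the dusty dense
set of ideator 3's B1).  `Q` = the SUMMIT's own settled conclusion MINUS the exhaustiveness clause — weaker than
the summit (`QT_of_summit`), `k = 2`, so it is what every capture route's endgame produces — and the route-owned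
item is the ∀-statement `BroomedReWitness`.  The first lemma `GT_of_QT_of_rewitness` is PROVED here. -/

section ReWitness

variable {X : Type} [TopologicalSpace X] [ChartedSpace E3 X] [IsManifold (𝓡 3) ∞ X] [ConnectedSpace X]

/-- `Q`'s pointwise property: the summit's settled conclusion with `HasExhaustiveCharts` removed (MGHD exists;
every MGHD has complete `𝓘⁺` and an `N`-hole `C²` decomposition of its self-determined exterior `O`, sub-extremal
holes, honest `O` (`RaysStayInClosure`), future-oriented charts).  No exhaustiveness, no `HonestCore`/`HonestFar`,
no `C⁴`: nothing on the necks and nothing the dust obstructs. -/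
def SettlesUnexhaustively (D : InitialDataSet (𝓡 3) X) : Prop :=
  (∃ 𝒟 : VacuumCauchyDevelopment D, 𝒟.IsMaximal) ∧
    ∀ 𝒟 : VacuumCauchyDevelopment D, 𝒟.IsMaximal →
      HasCompleteNullInfinity 𝒟.toCauchyDevelopment ∧
        ∃ (O : Set 𝒟.carrier) (d : FinalStateDecomposition 𝒟.toSpacetime O 2),
          (∀ i, Kerr.IsSubextremal (d.mass i) (d.spin i)) ∧
            O = exteriorOf 𝒟.toCauchyDevelopment d.charted ∧
              RaysStayInClosure 𝒟.toCauchyDevelopment O ∧ IsFutureOriented d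

variable (X) in
/-- **`BroomedReWitness X`** (route-owned, NO genericity quantifier): every tame curve of admissible data whose
members off `0` settle unexhaustively (the curve immersed-and-injective, or constant) can be RE-WITNESSED through
the same base datum by a tame, injective, immersed curve of admissible data (on some end) whose members off `0`
settle HONESTLY in `C⁴` with the honest-`O` clause (`SettlesHonestlyT`).  Intended proof (card): broom the members
(`F' t := breathe_t ^* broom_{ψ t} (F t)`), then BroomPersistence (settling survives all sufficiently far brooms)
and CleanReadOff (on Kerr-ended data unexhaustive settling upgrades to honest `C⁴` settling).  Verbatim the
hypothesis `hrel` of `isTameChristodoulouGeneric_of_relative'`. -/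
def BroomedReWitness : Prop :=
  ∀ (e : AFEnd X) (F : EuclideanSpace ℝ (Fin 1) → InitialDataSet (𝓡 3) X),
    InitialDataSet.IsTameDataFamily e 1 F →
      ((InitialDataSet.IsImmersedAtZero 1 F ∧ Injective F) ∨ ∀ c, F c = F 0) →
        (∀ c, F c ∈ admissibleVacuumData X) → (∀ c ≠ 0, SettlesUnexhaustively (F c)) →
          ∃ (e' : AFEnd X) (F' : EuclideanSpace ℝ (Fin 1) → InitialDataSet (𝓡 3) X),
            InitialDataSet.IsTameDataFamily e' 1 F' ∧ F' 0 = F 0 ∧ Injective F' ∧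
              InitialDataSet.IsImmersedAtZero 1 F' ∧
                (∀ c, F' c ∈ admissibleVacuumData X) ∧ ∀ c ≠ 0, SettlesHonestlyT (F' c)

end ReWitness

/-- **Q_T** — tame-generic UNEXHAUSTIVE settling: the summit statement with `HasExhaustiveCharts` deleted. -/
def QT : Prop :=
  ∀ (X : Type) [TopologicalSpace X] [ChartedSpace E3 X] [IsManifold (𝓡 3) ∞ X] [T2Space X]
    [SecondCountableTopology X] [ConnectedSpace X],
    InitialDataSet.IsTameChristodoulouGeneric (admissibleVacuumData X) SettlesUnexhaustively 1

/-- `Q_T` is WEAKER than the summit (monotonicity of tame genericity): the re-witnessing line turns route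
StarvedNecks into the reduction "summit ⇐ (summit minus exhaustiveness) + ∀-statements". PROVED. -/
theorem QT_of_summit (h : _root_.FinalStateConjecture) : QT := by
  intro X _ _ _ _ _ _
  refine (h X).mono ?_
  rintro D - ⟨hex, hall⟩
  refine ⟨hex, fun 𝒟 h𝒟 ↦ ?_⟩
  obtain ⟨hscri, O, d, hsub, hO, hrays, -, hfo⟩ := hall 𝒟 h𝒟
  exact ⟨hscri, O, d, hsub, hO, hrays, hfo⟩

/-- **FIRST LEMMA of card `broomed-rewitnessing` (PROVED): `Q_T ∧ BroomedReWitness ⇒ G′`.**  Genericity is spent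
once, in `Q_T`; everything route StarvedNecks owns is the ∀-statement `BroomedReWitness` (plus `NecksCertify`,
`SeamedChartsExhaust`).  Composition along curves: `isTameChristodoulouGeneric_of_relative'`. -/
theorem GT_of_QT_of_rewitness (hQ : QT)
    (hR : ∀ (X : Type) [TopologicalSpace X] [ChartedSpace E3 X] [IsManifold (𝓡 3) ∞ X] [T2Space X]
      [SecondCountableTopology X] [ConnectedSpace X], BroomedReWitness X) : GT := by
  intro X _ _ _ _ _ _
  refine InitialDataSet.isTameChristodoulouGeneric_of_relative' ?_ (hQ X) (hR X)
  intro d hd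
  obtain ⟨-, e, M, hsole, hdecay⟩ := id hd
  exact ⟨e, hsole, M, hdecay⟩

/-- … hence also the crux AS TYPED. -/
theorem G_of_QT_of_rewitness (hQ : QT)
    (hR : ∀ (X : Type) [TopologicalSpace X] [ChartedSpace E3 X] [IsManifold (𝓡 3) ∞ X] [T2Space X]
      [SecondCountableTopology X] [ConnectedSpace X], BroomedReWitness X) : G :=
  G_of_GT (GT_of_QT_of_rewitness hQ hR)

end Summit.FinalStateConjecture.FinalStateConjecture.Cruxes.HonestFixedRadiusSettling.JetAndBroom

end
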